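import Mathlib.LinearAlgebra.Matrix.Transvection
import Mathlib.LinearAlgebra.Matrix.MvPolynomial
import Literature.Computability.AlgebraicComplexity.BI17FundamentalInvariantForms
import Literature.Computability.AlgebraicComplexity.PowerSumNonvanishing
import Literature.Computability.AlgebraicComplexity.BIP19Plethysms
import HarnessLib

/-!
# Howe's theorem on `SL_m`-invariants of `m`-ary forms of low degree (BI 2017, Thm. 3.14): discharge

Topic `Literature/Computability/AlgebraicComplexity`; proofs file (theorems only, no definitions,
no named facts), companion of `BI17FundamentalInvariantForms.lean`, discharging its named fact
`BI2017_thm_3_14` — P. Bürgisser, C. Ikenmeyer, *Fundamental invariants of orbit closures*,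
J. Algebra 477 (2017), Thm. 3.14 (R. Howe, *(GL_n, GL_m)-duality and symmetric plethysm*,
Proc. Indian Acad. Sci. 97 (1987), Prop. 4.3): for `m ≥ 2`, `D ≥ 1`,

* `O(Sym^D ℂ^m)^{SL_m}_d = 0` for `0 < d < m`;
* `dim O(Sym^D ℂ^m)^{SL_m}_m = 1` if `D` is even, `= 0` if `D` is odd.

## Proof (elementary; NOT Howe's duality argument)

The printed proofs go through `(GL_n, GL_m)`-duality / symmetric plethysm. We replace them by an
argument over tools the tree already PROVES:

1. **Pull-back to power sums.** A polynomial function `F` on `Sym^D` of degree `≤ r` that is not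
   zero does not vanish at some power sum `ℓ_1^D + ⋯ + ℓ_r^D` of `r` linear forms
   (Bürgisser–Ikenmeyer–Panova 2019, Prop. 3.2; tree `exists_aeval_formCoeff_sum_linearFormPow_ne_zero`,
   algebraically closed field of characteristic zero). So `F ↦ G_F`, `G_F(A) = F(∑_i ℓ_{A_i}^D)`
   (`A` an `r × m` matrix of coefficients; tree `eval_aeval_coeff_genericPowerSum`), is injective
   on forms of degree `≤ r`, and `G_F` is homogeneous of degree `D·d` for `F` homogeneous of degree `d`.
2. **`d < m`: column elimination.** `SL_m`-invariance of `F` makes `G_F` invariant under adding a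
   multiple of one column of `A` to another (a transvection acting on the linear forms). A
   polynomial in a `d × m` matrix, `d < m`, with this invariance is CONSTANT: outside the zero set
   of a `d × d` minor every column is a combination of `d` other columns, so the polynomial does not
   depend on that column (`eq_C_of_forall_eval_colAdd_eq`). A constant homogeneous polynomial of
   positive degree is `0`; hence `F = 0` (`slInvariantsOfDegree_eq_bot_of_lt`).
3. **`d = m`: the character `det^D`.** Over an algebraically closed field an `SL_m`-invariant
   homogeneous `F` of degree `m` is a `GL_m`-semi-invariant: `F(B · q) = det(B)^D F(q)` (write
   `B = λ B₁`, `λ^m = det B`, `B₁ ∈ SL_m`; scalars act on `Sym^D` by `λ^D` and on degree-`m`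
   functions by `λ^{Dm}`). Hence `G_F = F(x_1^D + ⋯ + x_m^D) · det(A)^D` as polynomials
   (`aeval_coeff_powerSum_eq_C_mul_det_pow`). For `D` odd, swapping two rows of `A` fixes the power
   sum and changes the sign of `det^D`, so `F(x_1^D + ⋯ + x_m^D) = 0`, `G_F = 0`, `F = 0`. For `D` even
   every invariant `F` of degree `m` satisfies `m! · F = F(∑ x_i^D) · P_{D,m}` (both sides have the
   same `G`), where `P_{D,m}` is Cayley's invariant (tree `cayleyP`, with `P_{D,m}(B · q) = det(B)^D P_{D,m}(q)`
   = BI 2017 Thm. 3.18(1) `BI2017_thm_3_18_1` and `P_{D,m}(∑ x_i^D) = m!` = Thm. 3.18(2)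
   `BI2017_thm_3_18_2_powerSum`, both PROVED in the tree); and `P_{D,m}` is a nonzero element of
   `O(Sym^D)^{SL_m}_m`. So the space is the line `ℂ · P_{D,m}`.

Main results: `slInvariantsOfDegree_eq_bot_of_lt` (Howe, `d < m`; the column-elimination lemma
`eq_C_of_forall_eval_colAdd_eq` is file-private), `slInvariantsOfDegree_self_eq_bot_of_odd`, `cayleyP_mem_slInvariantsOfDegree`,
`slInvariantsOfDegree_self_eq_span_cayleyP`, `finrank_slInvariantsOfDegree_self_of_even` (Howe,
`d = m`), and the discharge `BI2017_thm_3_14_holds : BI2017_thm_3_14`.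

Honest framing (cell `val-lit`, rung V3): a discharge of a typed literature fact over proved tree
theorems; nothing here bears on VP ≠ VNP.

## References

* P. Bürgisser, C. Ikenmeyer, *Fundamental invariants of orbit closures*, J. Algebra 477 (2017)
  390–434 = arXiv:1511.02927, Thm. 3.14 (`\label{th:howe}`, main.tex L1119), Thm. 3.18.
  [BurgisserIkenmeyer2017]
* R. Howe, *(GL_n, GL_m)-duality and symmetric plethysm*, Proc. Indian Acad. Sci. Math. Sci. 97
  (1987) 85–109, Prop. 4.3 (the source BI cite for Thm. 3.14).
* P. Bürgisser, C. Ikenmeyer, G. Panova, *No occurrence obstructions in geometric complexity theory*,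
  J. AMS 32 (2019), Prop. 3.2 (nonvanishing on power sums with few terms). [BurgisserIkenmeyerPanovaJAMS2019]

## Tree

`slInvariantsOfDegree`, `mem_slInvariantsOfDegree_iff`, `IsSLInvariantCoord`,
`IsSLInvariantCoord.aeval_formCoeff_linSubst`, `cayleyP`, `BI2017_thm_3_18_1`, `BI2017_thm_3_18_2`,
`BI2017_thm_3_18_2_powerSum`, `BI2017_thm_3_14` (`BI17FundamentalInvariantForms`);
`isHomogeneous_hyperdetPoly` (`Hyperdeterminant`); `exists_aeval_formCoeff_sum_linearFormPow_ne_zero`,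
`eval_aeval_coeff_genericPowerSum`, `coeff_linearFormPow`, `exists_eval_ne_zero`
(`PowerSumNonvanishing`); `aeval_coeff_genericPowerSum_ne_zero` (BIP Prop. 3.2 pulled back to the
coefficients of the linear forms, `BIP19Plethysms`); `coordRep_apply`, `aeval_formCoeff_coordSubst`, `formCoeff_smul`
(`OrbitCoordinateRing`); `linSubst_X`, `linSubst_mul`, `linSubstRep_apply` (`LinSubst`);
`eval_smul_of_isHomogeneous` (`OrbitClosureProofs`); Mathlib `Matrix.transvection`,
`Matrix.det_transvection_of_ne`, `Matrix.mvPolynomialX`, `Matrix.det_mvPolynomialX_ne_zero`,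
`MvPolynomial.funext`, `MvPolynomial.IsHomogeneous.aeval`, `Function.Embedding.nonempty_iff_card_le`.
-/

noncomputable section

open MvPolynomial
open scoped BigOperators Matrix

namespace Literature.Computability.AlgebraicComplexity

/-! ### Column elimination: transvection-invariant polynomials in a `τ × σ` matrix, `|τ| < |σ|` -/

section ColumnElimination

variable {k : Type*} [Field k] {τ σ : Type*} [Fintype τ] [DecidableEq τ] [Fintype σ]
  [DecidableEq σ]

/-- Evaluation commutes with substitution: `(aeval g P)(A) = P(v ↦ (g v)(A))`. [folklore] -/
private theorem eval_aeval_eq_eval_pt {ι ι' : Type*} (A : ι' → k) (g : ι → MvPolynomial ι' k)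
    (P : MvPolynomial ι k) : eval A (aeval g P) = eval (fun v => eval A (g v)) P := by
  induction P using MvPolynomial.induction_on with
  | C a => rw [aeval_C, algebraMap_eq, eval_C, eval_C]
  | add p q hp hq => simp only [map_add, hp, hq]
  | mul_X p n hp => simp only [map_mul, hp, aeval_X, eval_X]

/-- Over the base field, `aeval` at a point is `eval`. [folklore] -/
private theorem aeval_eq_eval' {ι : Type*} (v : ι → k) (F : MvPolynomial ι k) :
    aeval v F = eval v F := rfl

omit [Fintype σ] in
/-- **Adding combinations of `d` columns spanning `k^τ` to a further column does not change the
value of a column-transvection-invariant polynomial**: if the `τ × τ` block of `A` in the columns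
`emb(τ)` (all different from `y`) is invertible, then `P(A) = P(A with column y replaced by 0)`.
[folklore] -/
private theorem eval_eq_eval_killCol (P : MvPolynomial (τ × σ) k)
    (hP : ∀ (A : τ × σ → k) (x y : σ), x ≠ y → ∀ s : k,
      eval (fun v => if v.2 = y then A v + s * A (v.1, x) else A v) P = eval A P)
    (y : σ) (emb : τ ↪ {z : σ // z ≠ y}) (A : τ × σ → k)
    (hA : (Matrix.of fun i j : τ => A (i, ((emb j : {z : σ // z ≠ y}) : σ))).det ≠ 0) :
    eval A P = eval (fun v => if v.2 = y then 0 else A v) P := by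
  set N : Matrix τ τ k := Matrix.of fun i j : τ => A (i, ((emb j : {z : σ // z ≠ y}) : σ)) with hN
  -- solve `N s = (column y)`
  set s : τ → k := N⁻¹ *ᵥ fun i => A (i, y) with hs
  have hNs : N *ᵥ s = fun i => A (i, y) := by
    rw [hs, Matrix.mulVec_mulVec, Matrix.mul_nonsing_inv _ (isUnit_iff_ne_zero.mpr hA),
      Matrix.one_mulVec]
  -- partial sums of the combination put into column `y`
  let AS : Finset τ → (τ × σ → k) := fun S v =>
    if v.2 = y then ∑ j ∈ S, A (v.1, ((emb j : {z : σ // z ≠ y}) : σ)) * s j else A v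
  have hstep : ∀ S : Finset τ, eval (AS S) P = eval (AS ∅) P := by
    intro S
    induction S using Finset.induction_on with
    | empty => rfl
    | insert j S hj ih =>
      have hne : (((emb j : {z : σ // z ≠ y}) : σ)) ≠ y := (emb j).2
      have hpt : AS (insert j S) = fun v =>
          if v.2 = y then AS S v + s j * AS S (v.1, ((emb j : {z : σ // z ≠ y}) : σ))
          else AS S v := by
        funext v
        by_cases hv : v.2 = y
        · simp only [AS, hv, if_true, Finset.sum_insert hj]
          have h2 : ¬ (((emb j : {z : σ // z ≠ y}) : σ)) = y := hne
          rw [if_neg h2]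
          ring
        · simp only [AS, hv, if_false]
      rw [hpt, hP (AS S) ((emb j : {z : σ // z ≠ y}) : σ) y hne (s j), ih]
  have hfull : AS Finset.univ = A := by
    funext v
    by_cases hv : v.2 = y
    · simp only [AS, hv, if_true]
      have h := congr_fun hNs v.1
      simp only [Matrix.mulVec, dotProduct, hN, Matrix.of_apply] at h
      rw [h]
      obtain ⟨a, b⟩ := v
      simp only at hv
      rw [hv]
    · simp only [AS, hv, if_false]
  have hempty : AS ∅ = fun v => if v.2 = y then 0 else A v := by
    funext v
    by_cases hv : v.2 = y
    · simp only [AS, hv, if_true, Finset.sum_empty]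
    · simp only [AS, hv, if_false]
  have h1 := hstep Finset.univ
  rw [hfull, hempty] at h1
  exact h1

variable [Infinite k]

/-- **One column can be killed**: a polynomial in a `τ × σ` matrix, `|τ| < |σ|`, invariant under
adding a multiple of any column to any other column, does not depend on column `y`:
`P = P ∘ (column y ↦ 0)` as polynomials (the two sides agree wherever a `τ × τ` minor avoiding
column `y` is invertible, a Zariski-dense set). [folklore] -/
private theorem eq_aeval_killCol (hcard : Fintype.card τ < Fintype.card σ)
    (P : MvPolynomial (τ × σ) k)
    (hP : ∀ (A : τ × σ → k) (x y : σ), x ≠ y → ∀ s : k,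
      eval (fun v => if v.2 = y then A v + s * A (v.1, x) else A v) P = eval A P) (y : σ) :
    P = aeval (fun v : τ × σ => if v.2 = y then (0 : MvPolynomial (τ × σ) k) else X v) P := by
  -- `τ` embeds into the columns different from `y`
  have hle : Fintype.card τ ≤ Fintype.card {z : σ // z ≠ y} := by
    have h1 : Fintype.card {z : σ // z ≠ y} = Fintype.card σ - Fintype.card {z : σ // z = y} :=
      Fintype.card_subtype_compl (fun z : σ => z = y)
    rw [Fintype.card_subtype_eq] at h1
    omega
  obtain ⟨emb⟩ := Function.Embedding.nonempty_iff_card_le.mpr hle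
  -- the minor on the columns `emb(τ)`
  set μ : MvPolynomial (τ × σ) k :=
    (Matrix.of fun i j : τ => (X (i, ((emb j : {z : σ // z ≠ y}) : σ)) : MvPolynomial (τ × σ) k)).det
    with hμ
  have heval_μ : ∀ A : τ × σ → k, eval A μ =
      (Matrix.of fun i j : τ => A (i, ((emb j : {z : σ // z ≠ y}) : σ))).det := by
    intro A
    rw [hμ, RingHom.map_det]
    congr 1
    ext i j
    simp [Matrix.of_apply]
  have hμ0 : μ ≠ 0 := by
    intro h0
    have h := heval_μ fun v => if v.2 = ((emb v.1 : {z : σ // z ≠ y}) : σ) then 1 else 0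
    rw [h0, map_zero] at h
    have hone : (Matrix.of fun i j : τ =>
        (if ((emb j : {z : σ // z ≠ y}) : σ) = ((emb i : {z : σ // z ≠ y}) : σ) then (1 : k)
          else 0)) = 1 := by
      ext i j
      rw [Matrix.of_apply, Matrix.one_apply]
      by_cases hij : i = j
      · subst hij; simp
      · have : ((emb j : {z : σ // z ≠ y}) : σ) ≠ ((emb i : {z : σ // z ≠ y}) : σ) := fun h' =>
          hij (emb.injective (Subtype.ext h')).symm
        rw [if_neg this, if_neg hij]
    rw [hone, Matrix.det_one] at h
    exact one_ne_zero h.symm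
  -- `(P - P∘kill) * μ` vanishes everywhere
  set Q : MvPolynomial (τ × σ) k :=
    P - aeval (fun v : τ × σ => if v.2 = y then (0 : MvPolynomial (τ × σ) k) else X v) P with hQ
  have hQμ : Q * μ = 0 := by
    apply MvPolynomial.funext
    intro A
    rw [map_mul, map_zero]
    by_cases hA : eval A μ = 0
    · rw [hA, mul_zero]
    · rw [heval_μ] at hA
      have hkill := eval_eq_eval_killCol P hP y emb A hA
      have hsub : eval A (aeval (fun v : τ × σ =>
          if v.2 = y then (0 : MvPolynomial (τ × σ) k) else X v) P) =
          eval (fun v => if v.2 = y then 0 else A v) P := by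
        have hfun : (fun v : τ × σ => eval A (if v.2 = y then (0 : MvPolynomial (τ × σ) k) else X v))
            = fun v => if v.2 = y then 0 else A v := by
          funext v
          split_ifs <;> simp
        rw [eval_aeval_eq_eval_pt, hfun]
      rw [hQ, map_sub, hsub, ← hkill, sub_self, zero_mul]
  have hQ0 : Q = 0 := (mul_eq_zero.mp hQμ).resolve_right hμ0
  rw [hQ, sub_eq_zero] at hQ0
  exact hQ0

/-- **Column elimination.** Let `P` be a polynomial in the entries of a `τ × σ` matrix over an
infinite field with `|τ| < |σ|`, invariant (as a function) under adding a multiple of any column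
to any other column — in particular, invariant under the right action of `SL_σ`. Then `P` is
constant. (Every column can be killed, `eq_aeval_killCol`; killing all of them leaves the constant
term.) This is the "dense orbit" half of the first fundamental theorem for `SL_m` acting on fewer
than `m` vectors: fewer than `m` generic vectors can be moved to any other such tuple. [folklore] -/
private theorem eq_C_of_forall_eval_colAdd_eq (hcard : Fintype.card τ < Fintype.card σ)
    (P : MvPolynomial (τ × σ) k)
    (hP : ∀ (A : τ × σ → k) (x y : σ), x ≠ y → ∀ s : k,
      eval (fun v => if v.2 = y then A v + s * A (v.1, x) else A v) P = eval A P) :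
    P = C (constantCoeff P) := by
  have hS : ∀ S : Finset σ,
      P = aeval (fun v : τ × σ => if v.2 ∈ S then (0 : MvPolynomial (τ × σ) k) else X v) P := by
    intro S
    induction S using Finset.induction_on with
    | empty => simp
    | insert y S hy ih =>
      have hk := eq_aeval_killCol hcard P hP y
      -- substitute the `y`-killed form of `P` into the `S`-killed form
      have h2 : P = aeval (fun v : τ × σ => if v.2 ∈ S then (0 : MvPolynomial (τ × σ) k) else X v)
          (aeval (fun v : τ × σ => if v.2 = y then (0 : MvPolynomial (τ × σ) k) else X v) P) := by
        rw [← hk]; exact ih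
      have hfun : (fun v : τ × σ => aeval (fun w : τ × σ =>
            if w.2 ∈ S then (0 : MvPolynomial (τ × σ) k) else X w)
            (if v.2 = y then (0 : MvPolynomial (τ × σ) k) else X v)) =
          fun v : τ × σ => if v.2 ∈ insert y S then (0 : MvPolynomial (τ × σ) k) else X v := by
        funext v
        by_cases hv : v.2 = y
        · simp [hv]
        · by_cases hvS : v.2 ∈ S
          · simp [hv, hvS]
          · simp [hv, hvS]
      exact h2.trans (by rw [← AlgHom.comp_apply, comp_aeval, hfun])
  have h := hS Finset.univ
  simp only [Finset.mem_univ, if_true] at h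
  rw [h, aeval_zero', algebraMap_eq]
  simp

end ColumnElimination

/-! ### Pulling polynomial functions on `Sym^D` back to power sums -/

section PullBack

variable {k : Type*} [Field k] {σ : Type*} [Fintype σ] [DecidableEq σ]

/-- The degree-`D` coefficients of the generic power sum `∑_{i<r} (∑_x Y_{(i,x)} X_x)^D` are
homogeneous of degree `D` in the coefficient variables `Y`. [folklore] -/
private theorem isHomogeneous_coeff_genericPowerSum (r D : ℕ) (d : DegIdx σ D) :
    (coeff d.1 (∑ i : Fin r,
      (∑ x, C (X (i, x)) * X x : MvPolynomial σ (MvPolynomial (Fin r × σ) k)) ^ D)).IsHomogeneous D := by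
  rw [coeff_sum]
  refine IsHomogeneous.sum _ _ _ fun i _ => ?_
  rw [coeff_linearFormPow, if_pos (mem_degMonomials_iff.mp d.2)]
  have hprod : (∏ x, (X (i, x) : MvPolynomial (Fin r × σ) k) ^ (d.1 x)).IsHomogeneous D := by
    have h := IsHomogeneous.prod Finset.univ (fun x => (X (i, x) : MvPolynomial (Fin r × σ) k) ^ (d.1 x))
      (fun x => d.1 x) fun x _ => isHomogeneous_X_pow (i, x) (d.1 x)
    have hdeg : ∑ x ∈ Finset.univ, d.1 x = D := by
      have hd : d.1.degree = D := mem_degMonomials_iff.mp d.2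
      rwa [Finsupp.degree_eq_sum] at hd
    rwa [hdeg] at h
  have := hprod.C_mul (Nat.multinomial Finset.univ d.1 : k)
  rwa [map_natCast] at this

/-- The pull-back `G_F` of a homogeneous `F` of degree `d` along the `r`-term power-sum map is
homogeneous of degree `D · d`. [folklore] -/
private theorem isHomogeneous_aeval_coeff_genericPowerSum (r D : ℕ) {F : MvPolynomial (DegIdx σ D) k}
    {d : ℕ} (hF : F.IsHomogeneous d) :
    (aeval (fun e : DegIdx σ D => coeff e.1 (∑ i : Fin r,
      (∑ x, C (X (i, x)) * X x : MvPolynomial σ (MvPolynomial (Fin r × σ) k)) ^ D)) F).IsHomogeneous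
      (D * d) :=
  hF.aeval _ fun e => isHomogeneous_coeff_genericPowerSum r D e

omit [DecidableEq σ] in
/-- A linear substitution acts on a linear form through the matrix–vector product:
`B · (∑_z v_z X_z) = ∑_j (B v)_j X_j` (`linSubst`: `X_z ↦ ∑_j B_{jz} X_j`). [folklore] -/
private theorem linSubst_linearForm (B : Matrix σ σ k) (v : σ → k) :
    linSubst σ k B (∑ z, C (v z) * X z : MvPolynomial σ k) = ∑ j, C ((B *ᵥ v) j) * X j := by
  have hL : linSubst σ k B (∑ z, C (v z) * X z : MvPolynomial σ k) =
      ∑ z, ∑ j, C (v z * B j z) * X j := by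
    rw [map_sum]
    refine Finset.sum_congr rfl fun z _ => ?_
    rw [map_mul, linSubst_C, linSubst_X, Finset.mul_sum]
    refine Finset.sum_congr rfl fun j _ => ?_
    rw [smul_eq_C_mul, map_mul, mul_assoc]
  have hR : (∑ j, C ((B *ᵥ v) j) * X j : MvPolynomial σ k) = ∑ j, ∑ z, C (v z * B j z) * X j := by
    refine Finset.sum_congr rfl fun j _ => ?_
    rw [Matrix.mulVec, dotProduct, map_sum, Finset.sum_mul]
    refine Finset.sum_congr rfl fun z _ => ?_
    rw [mul_comm (B j z)]
  rw [hL, hR, Finset.sum_comm]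

omit [DecidableEq σ] in
/-- A linear substitution acts on a power sum of linear forms row by row:
`B · ∑_i ℓ_{A_i}^D = ∑_i ℓ_{B A_i}^D`. [folklore] -/
private theorem linSubst_powerSum (B : Matrix σ σ k) {r : ℕ} (A : Fin r × σ → k) (D : ℕ) :
    linSubst σ k B (∑ i : Fin r, (∑ z, C (A (i, z)) * X z : MvPolynomial σ k) ^ D) =
      ∑ i : Fin r, (∑ j, C ((B *ᵥ fun z => A (i, z)) j) * X j : MvPolynomial σ k) ^ D := by
  rw [map_sum]
  exact Finset.sum_congr rfl fun i _ => by rw [map_pow, linSubst_linearForm]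

/-- **`SL`-invariance of `F` makes `G_F` invariant under column transvections**: adding `s` times
column `x` to column `y ≠ x` of the coefficient matrix is the transvection `1 + s E_{yx} ∈ SL_σ`
acting on the linear forms. [folklore] -/
private theorem eval_colAdd_aeval_coeff_genericPowerSum {r D : ℕ} {F : MvPolynomial (DegIdx σ D) k}
    (hF : IsSLInvariantCoord D F) (A : Fin r × σ → k) {x y : σ} (hxy : x ≠ y) (s : k) :
    eval (fun v => if v.2 = y then A v + s * A (v.1, x) else A v)
      (aeval (fun e : DegIdx σ D => coeff e.1 (∑ i : Fin r,
        (∑ z, C (X (i, z)) * X z : MvPolynomial σ (MvPolynomial (Fin r × σ) k)) ^ D)) F) =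
    eval A (aeval (fun e : DegIdx σ D => coeff e.1 (∑ i : Fin r,
        (∑ z, C (X (i, z)) * X z : MvPolynomial σ (MvPolynomial (Fin r × σ) k)) ^ D)) F) := by
  rw [eval_aeval_coeff_genericPowerSum, eval_aeval_coeff_genericPowerSum]
  -- the transvection `T = 1 + s E_{yx}` has determinant one and `T v = v + s v_x e_y`
  let T : Matrix.SpecialLinearGroup σ k :=
    ⟨Matrix.transvection y x s, Matrix.det_transvection_of_ne y x (Ne.symm hxy) s⟩
  have hT : ∀ i : Fin r, (Matrix.transvection y x s *ᵥ fun z => A (i, z)) =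
      fun j => if j = y then A (i, j) + s * A (i, x) else A (i, j) := by
    intro i
    funext j
    rw [Matrix.transvection, Matrix.add_mulVec, Matrix.one_mulVec, Pi.add_apply]
    have hsingle : (Matrix.single y x s *ᵥ fun z => A (i, z)) j = if j = y then s * A (i, x) else 0 := by
      rw [Matrix.mulVec, dotProduct]
      simp only [Matrix.single_apply]
      by_cases hj : j = y
      · subst hj
        simp
      · have hj' : ¬ y = j := fun h => hj h.symm
        simp [hj, hj']
    rw [hsingle]
    split_ifs <;> simp
  have h := hF.aeval_formCoeff_linSubst T (∑ i : Fin r, (∑ z, C (A (i, z)) * X z : MvPolynomial σ k) ^ D)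
  rw [show ((T : Matrix.SpecialLinearGroup σ k) : Matrix σ σ k) = Matrix.transvection y x s from rfl,
    linSubst_powerSum] at h
  simp only [hT] at h
  convert h using 4

end PullBack

/-! ### Howe's theorem for `d < m` -/

section HoweLow

variable {k : Type*} [Field k] [IsAlgClosed k] [CharZero k]

/-- **Howe's theorem, first part** (BI 2017 Thm. 3.14: "We have `O(Sym^D ℂ^m)^{SL_m}_d = 0` if
`d < m`"), for `0 < d < m`, `D ≥ 1`, over any algebraically closed field of characteristic zero:
a homogeneous `SL_m`-invariant polynomial function of degree `d` on `m`-ary forms of degree `D`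
is zero. Proof: its pull-back `G_F` to `d`-term power sums is a column-transvection-invariant
polynomial in a `d × m` matrix, hence constant (`eq_C_of_forall_eval_colAdd_eq`), and homogeneous
of degree `D d > 0`, hence `0`; but `G_F ≠ 0` if `F ≠ 0` (BIP Prop. 3.2).
[cite: BurgisserIkenmeyer2017, Thm. 3.14] -/
theorem slInvariantsOfDegree_eq_bot_of_lt {m D d : ℕ} (hD : 0 < D) (hd : 0 < d) (hdm : d < m) :
    slInvariantsOfDegree (Fin m) k D d = ⊥ := by
  rw [eq_bot_iff]
  intro F hF
  rw [Submodule.mem_bot]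
  obtain ⟨hFh, hFi⟩ := (mem_slInvariantsOfDegree_iff D d F).mp hF
  by_contra hF0
  -- the pull-back to `d`-term power sums
  set G : MvPolynomial (Fin d × Fin m) k := aeval (fun e : DegIdx (Fin m) D => coeff e.1
    (∑ i : Fin d, (∑ z, C (X (i, z)) * X z :
      MvPolynomial (Fin m) (MvPolynomial (Fin d × Fin m) k)) ^ D)) F with hG
  have hG0 : G ≠ 0 := aeval_coeff_genericPowerSum_ne_zero hD F hF0 hFh.totalDegree_le
  have hGh : G.IsHomogeneous (D * d) := isHomogeneous_aeval_coeff_genericPowerSum d D hFh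
  have hGc : G = C (constantCoeff G) :=
    eq_C_of_forall_eval_colAdd_eq (by simpa using hdm) G
      fun A x y hxy s => eval_colAdd_aeval_coeff_genericPowerSum hFi A hxy s
  -- a constant homogeneous polynomial of positive degree vanishes
  have hc0 : constantCoeff G ≠ 0 := by
    intro h0
    rw [h0, C_0] at hGc
    exact hG0 hGc
  have hdeg : (C (constantCoeff G) : MvPolynomial (Fin d × Fin m) k).IsHomogeneous 0 :=
    isHomogeneous_C _ _
  rw [← hGc] at hdeg
  have := hGh.inj_right hdeg hG0
  have hpos : 0 < D * d := Nat.mul_pos hD hd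
  omega

end HoweLow

/-! ### Howe's theorem for `d = m`: `SL`-invariants of degree `m` are multiples of `det^D` -/

section HoweTop

variable {k : Type*} [Field k]

/-- Scalar matrices act on forms of degree `D` by `c ^ D` (any field; the tree's
`linSubst_smul_of_isHomogeneous` is the case `k = ℂ`). [folklore] -/
private theorem linSubst_smul_one_eq [Infinite k] {σ : Type*} [Fintype σ] [DecidableEq σ]
    {q : MvPolynomial σ k} {D : ℕ} (hq : q.IsHomogeneous D) (c : k) :
    linSubst σ k (c • (1 : Matrix σ σ k)) q = c ^ D • q := by
  have hfun : (fun i : σ => ∑ j, (c • (1 : Matrix σ σ k)) j i • (X j : MvPolynomial σ k)) =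
      fun i => c • X i := by
    funext i
    simp only [Matrix.smul_apply, Matrix.one_apply, smul_eq_mul, mul_ite, mul_one, mul_zero,
      ite_smul, zero_smul]
    rw [Finset.sum_ite_eq' Finset.univ i, if_pos (Finset.mem_univ _)]
  unfold linSubst
  rw [hfun]
  apply MvPolynomial.funext
  intro x
  have hpt : (fun v : σ => eval x (c • X v : MvPolynomial σ k)) = c • x := by
    funext v
    rw [smul_eval, eval_X, Pi.smul_apply, smul_eq_mul]
  rw [eval_aeval_eq_eval_pt, hpt, eval_smul_of_isHomogeneous hq, smul_eval]

/-- The power sum `x_1^D + ⋯ + x_m^D` is a form of degree `D`. [folklore] -/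
private theorem isHomogeneous_powerSum (σ : Type*) [Fintype σ] (D : ℕ) :
    (∑ i : σ, (X i : MvPolynomial σ k) ^ D).IsHomogeneous D :=
  IsHomogeneous.sum _ _ _ fun i _ => isHomogeneous_X_pow i D

/-- **An `SL_m`-invariant of degree `m` is a `GL_m`-semi-invariant with character `det^D`**
(algebraically closed field): `F(B · q) = det(B)^D F(q)` for every invertible `B` and every form
`q` of degree `D`. Write `B = (λ⁻¹ B)(λ I)` with `λ^m = det B`: `λ I` acts on `q` by `λ^D` and
`F` is homogeneous of degree `m` in the coefficients, so `F` picks up `λ^{Dm} = det(B)^D`; and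
`λ⁻¹ B ∈ SL_m` acts trivially on `F` — the computation of BI 2017, proof of Lemma 3.2(1)
(main.tex L739–741: "For `g = t id_m` we have `det(g) = t^m` and `gw = t^D w`"), read for an
arbitrary invariant of degree `m`. [cite: BurgisserIkenmeyer2017, Lemma 3.2(1) (proof, main.tex L739–741; consequence)] -/
theorem IsSLInvariantCoord.aeval_formCoeff_linSubst_eq_det_pow_mul [IsAlgClosed k] {m D : ℕ}
    (hm : 0 < m) {F : MvPolynomial (DegIdx (Fin m) D) k} (hFi : IsSLInvariantCoord D F)
    (hFh : F.IsHomogeneous m) (B : Matrix (Fin m) (Fin m) k) (hB : B.det ≠ 0)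
    {q : MvPolynomial (Fin m) k} (hq : q.IsHomogeneous D) :
    aeval (formCoeff D (linSubst (Fin m) k B q)) F = B.det ^ D * aeval (formCoeff D q) F := by
  obtain ⟨c, hc⟩ := IsAlgClosed.exists_pow_nat_eq B.det hm
  have hc0 : c ≠ 0 := by
    rintro rfl
    rw [zero_pow hm.ne'] at hc
    exact hB hc.symm
  have hdet1 : (c⁻¹ • B).det = 1 := by
    rw [Matrix.det_smul, Fintype.card_fin, ← hc, inv_pow, inv_mul_cancel₀ (pow_ne_zero _ hc0)]
  let g : Matrix.SpecialLinearGroup (Fin m) k := ⟨c⁻¹ • B, hdet1⟩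
  have hB' : B = (c⁻¹ • B) * (c • (1 : Matrix (Fin m) (Fin m) k)) := by
    rw [Matrix.mul_smul, Matrix.mul_one, smul_smul, mul_inv_cancel₀ hc0, one_smul]
  have hinv : aeval (formCoeff D (linSubst (Fin m) k (c⁻¹ • B) q)) F = aeval (formCoeff D q) F :=
    hFi.aeval_formCoeff_linSubst g q
  conv_lhs => rw [hB', linSubst_mul, AlgHom.comp_apply, linSubst_smul_one_eq hq, map_smul,
    formCoeff_smul, aeval_eq_eval', eval_smul_of_isHomogeneous hFh, ← aeval_eq_eval', hinv]
  rw [← pow_mul, ← hc, ← pow_mul, mul_comm m D]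

/-- **The pull-back of an `SL_m`-invariant `F` of degree `m` to `m`-term power sums is
`F(x_1^D + ⋯ + x_m^D) · det(A)^D`** (as polynomials in the `m × m` coefficient matrix `A`;
algebraically closed field): `∑_i ℓ_{A_i}^D = Aᵀ · (∑_i x_i^D)`, so the two sides agree at
every invertible `A` by the semi-invariance, and their difference times `det(A) ≠ 0` vanishes
identically. This is BI 2017 Lemma 3.2(2) ("`O(Gw)^{SL_m}_d = ℂ · (φ_w)^k`", `φ_w(g w) = det(g)^{a(w)}`)
for the power sum `w = x_1^D + ⋯ + x_m^D`, read through the pull-back.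
[cite: BurgisserIkenmeyer2017, Lemma 3.2 (for w = x_1^D + ⋯ + x_m^D; consequence)] -/
theorem aeval_coeff_genericPowerSum_eq_C_mul_det_pow [IsAlgClosed k] {m D : ℕ} (hm : 0 < m)
    {F : MvPolynomial (DegIdx (Fin m) D) k} (hFi : IsSLInvariantCoord D F)
    (hFh : F.IsHomogeneous m) :
    aeval (fun e : DegIdx (Fin m) D => coeff e.1 (∑ i : Fin m,
      (∑ z, C (X (i, z)) * X z : MvPolynomial (Fin m) (MvPolynomial (Fin m × Fin m) k)) ^ D)) F =
    C (aeval (formCoeff D (∑ i : Fin m, (X i : MvPolynomial (Fin m) k) ^ D)) F) *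
      (Matrix.mvPolynomialX (Fin m) (Fin m) k).det ^ D := by
  set G := aeval (fun e : DegIdx (Fin m) D => coeff e.1 (∑ i : Fin m,
      (∑ z, C (X (i, z)) * X z : MvPolynomial (Fin m) (MvPolynomial (Fin m × Fin m) k)) ^ D)) F
    with hG
  set R := C (aeval (formCoeff D (∑ i : Fin m, (X i : MvPolynomial (Fin m) k) ^ D)) F) *
      (Matrix.mvPolynomialX (Fin m) (Fin m) k).det ^ D with hR
  -- values of `det X` and of the two sides
  have hdet : ∀ φ : Fin m × Fin m → k, eval φ (Matrix.mvPolynomialX (Fin m) (Fin m) k).det =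
      (Matrix.of fun i j : Fin m => φ (i, j)).det := by
    intro φ
    rw [RingHom.map_det]
    exact congrArg Matrix.det (Matrix.mvPolynomialX_mapMatrix_eval (Matrix.of fun i j : Fin m => φ (i, j)))
  have hQ : (G - R) * (Matrix.mvPolynomialX (Fin m) (Fin m) k).det = 0 := by
    apply MvPolynomial.funext
    intro φ
    rw [map_mul, map_zero, hdet]
    by_cases hφ : (Matrix.of fun i j : Fin m => φ (i, j)).det = 0
    · rw [hφ, mul_zero]
    -- at an invertible point both sides are `det^D · F(power sum)`
    have hps : (∑ i : Fin m, (∑ x, C (φ (i, x)) * X x : MvPolynomial (Fin m) k) ^ D) =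
        linSubst (Fin m) k (Matrix.of fun i j : Fin m => φ (i, j))ᵀ
          (∑ i : Fin m, (X i : MvPolynomial (Fin m) k) ^ D) := by
      rw [map_sum]
      refine Finset.sum_congr rfl fun i _ => ?_
      rw [map_pow, linSubst_X]
      congr 1
      refine Finset.sum_congr rfl fun j _ => ?_
      rw [smul_eq_C_mul, Matrix.transpose_apply, Matrix.of_apply]
    have hGφ : eval φ G = (Matrix.of fun i j : Fin m => φ (i, j)).det ^ D *
        aeval (formCoeff D (∑ i : Fin m, (X i : MvPolynomial (Fin m) k) ^ D)) F := by
      rw [hG, eval_aeval_coeff_genericPowerSum, hps, ← Matrix.det_transpose]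
      exact hFi.aeval_formCoeff_linSubst_eq_det_pow_mul hm hFh _
        (by rwa [Matrix.det_transpose]) (isHomogeneous_powerSum (Fin m) D)
    have hRφ : eval φ R = aeval (formCoeff D (∑ i : Fin m, (X i : MvPolynomial (Fin m) k) ^ D)) F *
        (Matrix.of fun i j : Fin m => φ (i, j)).det ^ D := by
      rw [hR, map_mul, map_pow, eval_C, hdet]
    rw [map_sub, hGφ, hRφ, mul_comm ((Matrix.of fun i j : Fin m => φ (i, j)).det ^ D), sub_self,
      zero_mul]
  have h0 : G - R = 0 := (mul_eq_zero.mp hQ).resolve_right (Matrix.det_mvPolynomialX_ne_zero _ _)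
  exact sub_eq_zero.mp h0

/-- The power sum is fixed by permutation matrices: `P_π · (x_1^D + ⋯ + x_m^D) = ∑ x_i^D`. [folklore] -/
private theorem linSubst_permMatrix_powerSum {m : ℕ} (π : Equiv.Perm (Fin m)) (D : ℕ) :
    linSubst (Fin m) k (π.permMatrix k) (∑ i : Fin m, (X i : MvPolynomial (Fin m) k) ^ D) =
      ∑ i : Fin m, (X i : MvPolynomial (Fin m) k) ^ D := by
  rw [linSubst_permMatrix, map_sum]
  simp only [map_pow, rename_X]
  exact Equiv.sum_comp π.symm (fun i => (X i : MvPolynomial (Fin m) k) ^ D)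

/-- **Howe's theorem, odd case** (BI 2017 Thm. 3.14: "`O(Sym^D ℂ^m)^{SL_m}_m` is … zero
dimensional if `D` is odd"), `m ≥ 2`, over an algebraically closed field of characteristic zero:
an `SL_m`-invariant `F` of degree `m` has `F(P_π · q) = det(P_π)^D F(q) = -F(q)` at the power sum
`q = ∑ x_i^D` fixed by the transposition `π`, so `F(∑ x_i^D) = 0`, its pull-back
`F(∑ x_i^D) det^D` vanishes, and `F = 0` (BIP Prop. 3.2). [cite: BurgisserIkenmeyer2017, Thm. 3.14] -/
theorem slInvariantsOfDegree_self_eq_bot_of_odd [IsAlgClosed k] [CharZero k] {m D : ℕ}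
    (hD : Odd D) (hm : 2 ≤ m) : slInvariantsOfDegree (Fin m) k D m = ⊥ := by
  rw [eq_bot_iff]
  intro F hF
  rw [Submodule.mem_bot]
  obtain ⟨hFh, hFi⟩ := (mem_slInvariantsOfDegree_iff D m F).mp hF
  have hm0 : 0 < m := by omega
  have hD0 : 0 < D := hD.pos
  -- the value at the power sum vanishes: swap two variables
  set c := aeval (formCoeff D (∑ i : Fin m, (X i : MvPolynomial (Fin m) k) ^ D)) F with hc
  let π : Equiv.Perm (Fin m) := Equiv.swap (⟨0, hm0⟩ : Fin m) ⟨1, by omega⟩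
  have hπ : Equiv.Perm.sign π = -1 := Equiv.Perm.sign_swap (by simp [Fin.ext_iff])
  have hdetπ : (π.permMatrix k).det = -1 := by
    rw [Matrix.det_permutation, hπ]
    simp
  have hval := hFi.aeval_formCoeff_linSubst_eq_det_pow_mul hm0 hFh (π.permMatrix k)
    (by rw [hdetπ]; exact neg_ne_zero.mpr one_ne_zero) (isHomogeneous_powerSum (Fin m) D)
  rw [linSubst_permMatrix_powerSum, hdetπ, hD.neg_one_pow, neg_one_mul] at hval
  have hc0 : c = 0 := by
    have h2 : c + c = 0 := by rw [hc]; nth_rewrite 1 [hval]; rw [neg_add_cancel]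
    exact add_self_eq_zero.mp h2
  -- hence the pull-back vanishes, hence `F = 0`
  by_contra hF0
  have hG := aeval_coeff_genericPowerSum_eq_C_mul_det_pow hm0 hFi hFh
  rw [← hc, hc0, C_0, zero_mul] at hG
  exact aeval_coeff_genericPowerSum_ne_zero hD0 F hF0 hFh.totalDegree_le hG

/-- A coefficient vector is the coefficient vector of the form it defines. [folklore] -/
private theorem formCoeff_sum_monomial {σ : Type*} [Fintype σ] [DecidableEq σ] {D : ℕ}
    (c : DegIdx σ D → k) : formCoeff D (∑ d : DegIdx σ D, monomial d.1 (c d)) = c := by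
  funext d
  rw [formCoeff_apply, coeff_sum, Finset.sum_eq_single d]
  · rw [coeff_monomial, if_pos rfl]
  · intro d' _ hne
    rw [coeff_monomial, if_neg (fun h => hne (Subtype.ext h))]
  · intro h; exact absurd (Finset.mem_univ d) h

/-- **Cayley's invariant `P_{D,m}` lies in `O(Sym^D)^{SL_m}_m`**: it is homogeneous of degree `m`
(`isHomogeneous_hyperdetPoly`) and `SL_m`-invariant as a polynomial function, by BI 2017
Thm. 3.18(1) (`P_{D,m}(B · q) = det(B)^D P_{D,m}(q)`, tree `BI2017_thm_3_18_1`) at every point of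
`Sym^D` (characteristic zero, so that polynomials are functions). [cite: BurgisserIkenmeyer2017, Thm. 3.18(1)] -/
theorem cayleyP_mem_slInvariantsOfDegree [CharZero k] (m D : ℕ) :
    cayleyP (k := k) D (Equiv.refl (Fin m)) ∈ slInvariantsOfDegree (Fin m) k D m := by
  rw [mem_slInvariantsOfDegree_iff]
  refine ⟨isHomogeneous_hyperdetPoly _, fun g => ?_⟩
  apply MvPolynomial.funext
  intro c
  -- evaluate at the form `q` with coefficient vector `c`
  set q : MvPolynomial (Fin m) k := ∑ d : DegIdx (Fin m) D, monomial d.1 (c d) with hq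
  have hqc : formCoeff D q = c := formCoeff_sum_monomial c
  have hqh : q.IsHomogeneous D :=
    IsHomogeneous.sum _ _ _ fun d _ => isHomogeneous_monomial _ (mem_degMonomials_iff.mp d.2)
  rw [← hqc]
  change aeval (formCoeff D q) (coordRep (Fin m) k D (Matrix.SpecialLinearGroup.toGL g)
    (cayleyP (k := k) D (Equiv.refl (Fin m)))) = aeval (formCoeff D q) (cayleyP (k := k) D (Equiv.refl (Fin m)))
  rw [coordRep_apply, aeval_formCoeff_coordSubst, linSubstRep_apply, BI2017_thm_3_18_1 _ hqh]
  have hdet : (((Matrix.SpecialLinearGroup.toGL g)⁻¹ : GL (Fin m) k) : Matrix (Fin m) (Fin m) k).det = 1 := by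
    rw [← map_inv, Matrix.SpecialLinearGroup.coe_GL_coe_matrix]
    exact (g⁻¹).det_coe
  rw [hdet, one_pow, one_mul]

/-- **Howe's theorem, even case, as an equality of spaces**: for `D ≥ 2` even and `m ≥ 2`, over an
algebraically closed field of characteristic zero, `O(Sym^D)^{SL_m}_m` is the line spanned by
Cayley's invariant `P_{D,m}`: for an invariant `F` of degree `m` the combination
`F(∑ x_i^D) · P_{D,m} - m! · F` is an invariant whose pull-back `(F(∑ x_i^D) · m! - m! · F(∑ x_i^D)) det^D`
vanishes (`P_{D,m}(∑ x_i^D) = m!`, tree `BI2017_thm_3_18_2_powerSum`), hence is `0` (BIP Prop. 3.2).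
[cite: BurgisserIkenmeyer2017, Thm. 3.14] -/
theorem slInvariantsOfDegree_self_eq_span_cayleyP [IsAlgClosed k] [CharZero k] {m D : ℕ}
    (hD : Even D) (hD0 : 0 < D) (hm : 2 ≤ m) :
    slInvariantsOfDegree (Fin m) k D m = k ∙ cayleyP (k := k) D (Equiv.refl (Fin m)) := by
  have hm0 : 0 < m := by omega
  have hPmem := cayleyP_mem_slInvariantsOfDegree (k := k) m D
  refine le_antisymm ?_ ((Submodule.span_singleton_le_iff_mem _ _).mpr hPmem)
  intro F hF
  obtain ⟨hFh, hFi⟩ := (mem_slInvariantsOfDegree_iff D m F).mp hF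
  set P := cayleyP (k := k) D (Equiv.refl (Fin m)) with hPdef
  set p : MvPolynomial (Fin m) k := ∑ i : Fin m, (X i : MvPolynomial (Fin m) k) ^ D with hp
  -- `P(p) = m!`
  have hPp : aeval (formCoeff D p) P = (Nat.factorial m : k) := by
    have h := BI2017_thm_3_18_2_powerSum (k := k) hD hD0 (Equiv.refl (Fin m))
    simpa using h
  set cF := aeval (formCoeff D p) F with hcF
  -- the invariant `H = cF • P - m! • F` has vanishing pull-back
  set H := cF • P - (Nat.factorial m : k) • F with hH
  have hHmem : H ∈ slInvariantsOfDegree (Fin m) k D m :=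
    Submodule.sub_mem _ (Submodule.smul_mem _ _ hPmem) (Submodule.smul_mem _ _ hF)
  obtain ⟨hHh, hHi⟩ := (mem_slInvariantsOfDegree_iff D m H).mp hHmem
  have hHp : aeval (formCoeff D p) H = 0 := by
    rw [hH, map_sub, map_smul, map_smul, hPp, smul_eq_mul, smul_eq_mul, mul_comm, sub_self]
  have hH0 : H = 0 := by
    by_contra hne
    have hG := aeval_coeff_genericPowerSum_eq_C_mul_det_pow hm0 hHi hHh
    rw [hHp, C_0, zero_mul] at hG
    exact aeval_coeff_genericPowerSum_ne_zero hD0 H hne hHh.totalDegree_le hG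
  -- so `m! • F = cF • P`
  have hfac : (Nat.factorial m : k) ≠ 0 := Nat.cast_ne_zero.mpr (Nat.factorial_ne_zero m)
  rw [Submodule.mem_span_singleton]
  refine ⟨(Nat.factorial m : k)⁻¹ * cF, ?_⟩
  rw [hH, sub_eq_zero] at hH0
  rw [mul_smul, hH0, smul_smul, inv_mul_cancel₀ hfac, one_smul]

/-- **Howe's theorem, even case** (BI 2017 Thm. 3.14: "`O(Sym^D ℂ^m)^{SL_m}_m` is one-dimensional
if `D` is even"), `D ≥ 2` even, `m ≥ 2`, algebraically closed field of characteristic zero.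
[cite: BurgisserIkenmeyer2017, Thm. 3.14] -/
theorem finrank_slInvariantsOfDegree_self_of_even [IsAlgClosed k] [CharZero k] {m D : ℕ}
    (hD : Even D) (hD0 : 0 < D) (hm : 2 ≤ m) :
    Module.finrank k (slInvariantsOfDegree (Fin m) k D m) = 1 := by
  rw [slInvariantsOfDegree_self_eq_span_cayleyP hD hD0 hm, finrank_span_singleton]
  exact (BI2017_thm_3_18_2 hm hD0 _).mpr hD

end HoweTop

/-! ### The discharge -/

section Discharge

/-- **BI 2017, Thm. 3.14 (Howe 1987, Prop. 4.3) — DISCHARGE of the named fact `BI2017_thm_3_14`**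
(`BI17FundamentalInvariantForms.lean`): "We have `O(Sym^D ℂ^m)^{SL_m}_d = 0` if `d < m`. Moreover,
`O(Sym^D ℂ^m)^{SL_m}_m` is one-dimensional if `D` is even and zero-dimensional if `D` is odd"
(`D ≥ 1`, `m ≥ 2`, `0 < d`). Assembled from `slInvariantsOfDegree_eq_bot_of_lt`,
`finrank_slInvariantsOfDegree_self_of_even`, `slInvariantsOfDegree_self_eq_bot_of_odd`.
[cite: BurgisserIkenmeyer2017, Thm. 3.14] -/
theorem BI2017_thm_3_14_holds : BI2017_thm_3_14 := by
  intro D m hD hm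
  refine ⟨fun d hd hdm => slInvariantsOfDegree_eq_bot_of_lt (k := ℂ) hD hd hdm, ?_⟩
  split_ifs with hE
  · exact finrank_slInvariantsOfDegree_self_of_even (k := ℂ) hE hD hm
  · rw [slInvariantsOfDegree_self_eq_bot_of_odd (k := ℂ) (Nat.not_even_iff_odd.mp hE) hm,
      finrank_bot]

end Discharge

end Literature.Computability.AlgebraicComplexity

end
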